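import Summits.ResolutionOfSingularities.ResolutionOfSingularities.Theorems.PurelyInseparableDim4JointHereditaryDefs
import Summits.ResolutionOfSingularities.ResolutionOfSingularities.Theorems.PurelyInseparableDim4JointWaitingKidShape
import Summits.ResolutionOfSingularities.ResolutionOfSingularities.Theorems.PurelyInseparableDim4JointWaitingRootHostData
import Literature.AlgebraicGeometry.Resolution.BlowupRestrictOpen
import HarnessLib

/-!
# Purely inseparable four-folds: `MemberDataH` of a ROOT HOST with hereditary waiting data (model terms) (brick S3 (c) «joint
# point∘coordinate chains», part 66a = v3-H, root host data; cell `res-dim4-pi`)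

[OURS · counted 0] (D-0157 DOOR 2; host item stmt-ResolutionOfSingularities-16155, helper). Nothing here proves resolution of singularities
in dimension ≥ 4 / characteristic `p`. Part 55a (`root_host_memberData`) in the v3-H format of part 60: a translated coordinate ROOT host
`(b, S)` of `z^p + F` (state `s = (deletePthPowers F(x + b), 0, ∅)`) whose pairs below satisfy `BlockH` and whose edge relation
`HEdge` is well-founded at `(s, S)` carries `MemberDataH` for `((z^p + F)·𝒪, ∅, p)` with the z-form regions
`wr (j, c, T) = φ(V(z, x_T − c_T))`; the boundary is empty, so the model-free invariants are vacuous. Coordinate descriptions for the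
root cover: points of the host have `x_i = b_i` (`i ∈ S`) and closed hypersurface points with these coordinates lie on it; points of a
region have `x_i = b_i + c_i` (`i ∈ T`), and — because `V(z, x_T)` is permissible for `s.F(x + c)` — every CLOSED point of the
hypersurface with these coordinates lies in the region (its cleaned `z`-coordinate vanishes: part 58 §1).

* `isClosed_waitingSetZ`, **`root_host_memberDataH`**. AI-produced formalisation, weaker than expert review.
bears_on: LADDER-RESOLUTION:D157-DOOR2 (res-dim4-pi · S3 (c) joint v3-H · root host data).
-/

set_option linter.dupNamespace false -- D-0017: single-problem summit path `Summit.<S>.<S>.…` by design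

noncomputable section

open MvPolynomial Finset CategoryTheory AlgebraicGeometry Opposite TopologicalSpace
open AlgebraicGeometry.Scheme.IdealSheafData (ofIdealTop vanishingIdeal)

namespace Summit.ResolutionOfSingularities.ResolutionOfSingularities.Theorems.PIDim4

open Literature.AlgebraicGeometry.Resolution
open Literature.AlgebraicGeometry.Resolution.Hauser2010
open Literature.AlgebraicGeometry.Resolution.AffinePointBlowup (P A γ coord Wtop ξ)

namespace Equimultiple

section RootHostDataH

variable {K : Type} [Field K] {p : ℕ} [hp : Fact p.Prime] [CharP K p]

omit hp [CharP K p] in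
/-- The z-form waiting coordinate subspace `V(z, x_T − c_T)` is closed: it is the zero locus of `z` and the `x_i − c_i`.
[cite: StacksProject, Tag 00E0 (closed subsets of Spec = zero loci)] -/
theorem isClosed_waitingSetZ (wt : Fin 4 × (Fin 4 → K) × Finset (Fin 4)) : IsClosed (waitingSetZ (K := K) wt) := by
  have h : waitingSetZ (K := K) wt = PrimeSpectrum.zeroLocus
      (insert (X 0 : A 4 K) ((fun i : Fin 4 => (X i.succ - C (wt.2.1 i) : A 4 K)) '' (wt.2.2 : Set (Fin 4)))) := by
    ext x
    rw [mem_waitingSetZ_iff]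
    show _ ↔ insert (X 0 : A 4 K) ((fun i : Fin 4 => (X i.succ - C (wt.2.1 i) : A 4 K)) '' (wt.2.2 : Set (Fin 4))) ⊆
      (x.asIdeal : Set (A 4 K))
    rw [Set.insert_subset_iff, Set.image_subset_iff]
    rfl
  rw [h]
  exact PrimeSpectrum.isClosed_zeroLocus _

/-- **`MemberDataH` OF A ROOT HOST (model terms).** See the module docstring.
[cite: BierstoneGrigorievMilmanWlodarczyk2011, Def. 3.1.3] [cite: Hauser2010, §G]
[cite: HauserPerlega2019PRIMS, §2 (permissible centres P = (z, x_i : i ∈ Γ))] -/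
theorem root_host_memberDataH [IsAlgClosed K] [DecidableEq K] (F : MvPolynomial (Fin 4) K) (hF : F ≠ 0)
    (hclean : Literature.Barriers.ResolutionOfSingularities.HauserPerlega.IsClean p F)
    (plan : State K → Finset (Fin 4) → Finset (Fin 4 × (Fin 4 → K) × Finset (Fin 4)))
    (leaves : State K → Finset (Fin 4) → Finset (Fin 4 × (Fin 4 → K)))
    (wplan : State K → Finset (Fin 4) → Finset (Fin 4 × (Fin 4 → K) × Finset (Fin 4)))
    (b : Fin 4 → K) (S : Finset (Fin 4)) (s : State K) (hs : s = ⟨deletePthPowers p (PointBlowup.translate b F), 0, ∅⟩)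
    (hS : IsPermissibleCentre p S s.F)
    (hblocks : ∀ q : State K × Finset (Fin 4),
      Relation.ReflTransGen (fun a e : State K × Finset (Fin 4) => HEdge p plan wplan e a) (s, S) q → BlockH p plan leaves wplan q)
    (hacc : Acc (fun q' q : State K × Finset (Fin 4) => HEdge p plan wplan q' q) (s, S)) :
    ∃ (c₀ : Closeds (P 4 K)) (wr : Fin 4 × (Fin 4 → K) × Finset (Fin 4) → Closeds (P 4 K)),
      MemberDataH p plan leaves wplan (⟨hypSheaf p F, [], p⟩ : MarkedIdeal (P 4 K)) c₀ s S wr ∧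
      (∀ z : P 4 K, z ∈ (c₀ : Set (P 4 K)) → ∀ i ∈ S, (X i.succ - C (b i) : A 4 K) ∈ z.asIdeal) ∧
      (∀ z : P 4 K, IsClosed ({z} : Set (P 4 K)) → (1 : ℕ∞) ≤ idealOrder (hypSheaf p F) z →
        (∀ i ∈ S, (X i.succ - C (b i) : A 4 K) ∈ z.asIdeal) → z ∈ (c₀ : Set (P 4 K))) ∧
      (∀ wt ∈ wplan s S, ∀ z : P 4 K, z ∈ (wr wt : Set (P 4 K)) →
        ∀ i ∈ wt.2.2, (X i.succ - C (b i + wt.2.1 i) : A 4 K) ∈ z.asIdeal) ∧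
      (∀ wt ∈ wplan s S, ∀ z : P 4 K, (1 : ℕ∞) ≤ idealOrder (hypSheaf p F) z →
        (∀ i ∈ wt.2.2, (X i.succ - C (b i + wt.2.1 i) : A 4 K) ∈ z.asIdeal) → z ∈ (wr wt : Set (P 4 K))) := by
  classical
  have hp0 : p ≠ 0 := hp.out.ne_zero
  have hF₀ : s.F ≠ 0 := by rw [hs]; exact deletePthPowers_translate_ne_zero hF hclean b
  have hclean₀ : Literature.Barriers.ResolutionOfSingularities.HauserPerlega.IsClean p s.F := by
    rw [hs]; exact isClean_deletePthPowers _
  have hS' : IsPermissibleCentre p S (deletePthPowers p (PointBlowup.translate b F)) := by rw [hs] at hS; exact hS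
  obtain ⟨φ, _, c₀, hsurj, hMφ, hcoord', -, hreg₀, hsnc₀, hZ₀, hin₀, hon₀⟩ := root_host_package (p := p) F b hS'
  have hMφ' : (hypSheaf p F).comap φ = hypSheaf p s.F := by rw [hs]; exact hMφ
  have hM : (⟨hypSheaf p F, [], p⟩ : MarkedIdeal (P 4 K)).ideal.comap φ = (hypSheaf p s.F).comap (𝟙 (P 4 K)) := by
    rw [Scheme.IdealSheafData.comap_id]; exact hMφ'
  have hZφ : (vanishingIdeal c₀).comap φ =
      (AffineCoordBlowup.𝓘Λ 4 K (insert 0 (Fin.succ '' (S : Set (Fin 4))))).comap (𝟙 (P 4 K)) := by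
    rw [Scheme.IdealSheafData.comap_id]; exact hZ₀
  have hnil : ∀ D : (P 4 K).IdealSheafData, D ∉ (⟨hypSheaf p F, [], p⟩ : MarkedIdeal (P 4 K)).boundary :=
    fun D hD => (List.mem_nil_iff D).mp hD
  have hW1 := (hblocks (s, S) Relation.ReflTransGen.refl).2.2.2.1
  set wr : Fin 4 × (Fin 4 → K) × Finset (Fin 4) → Closeds (P 4 K) := fun wt =>
    ⟨φ '' waitingSetZ wt, isClosed_image_of_surjective φ hsurj _ (isClosed_waitingSetZ wt)⟩ with hwr
  refine ⟨c₀, wr, ⟨hF₀, hclean₀, hS, hreg₀, hsnc₀, ⟨P 4 K, φ, 𝟙 _, inferInstance, inferInstance, hM, hZφ,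
    fun z _ => hsurj z, fun y _ => ⟨y, rfl⟩, ⟨fun _ => 0, fun _ => 0, fun D hD _ => absurd hD (hnil D),
      fun D₁ hD₁ _ _ _ _ _ => absurd hD₁ (hnil D₁)⟩, fun wt _ => ⟨rfl, fun y _ => ⟨y, rfl⟩⟩⟩,
    hblocks, hacc, fun wt _ D hD => absurd hD (hnil D), fun _ D hD => absurd hD (hnil D)⟩, hin₀, hon₀,
    fun wt _ z hz i hi => ?_, fun wt hwt z hord hz => ?_⟩
  · -- coordinates of the points of a region
    obtain ⟨y, hy, rfl⟩ := hz
    exact (hcoord' y i (wt.2.1 i)).mpr (((mem_waitingSetZ_iff wt y).mp hy).2 i hi)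
  · -- a hypersurface point with the region's coordinates lies in the region (its cleaned `z`-coordinate vanishes)
    obtain ⟨y, rfl⟩ := hsurj z
    refine ⟨y, (mem_waitingSetZ_iff wt y).mpr ⟨?_, fun i hi => (hcoord' y i (wt.2.1 i)).mp (hz i hi)⟩, rfl⟩
    have hx : ∀ i ∈ wt.2.2, (X i.succ - C (wt.2.1 i) : A 4 K) ∈ y.asIdeal := fun i hi => (hcoord' y i (wt.2.1 i)).mp (hz i hi)
    have hord' : (1 : ℕ∞) ≤ idealOrder (hypSheaf p s.F) y := by
      rw [← hMφ', idealOrder_comap_of_isOpenImmersion]; exact hord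
    have hsupp := (one_le_idealOrder_iff _ y).mp hord'
    have hhyp : (hyp p s.F : A 4 K) ∈ y.asIdeal := by
      have h := hsupp
      rw [hypSheaf, ofIdealTop_span_γ_symm_eq_shf] at h
      change y ∈ ((Literature.AlgebraicGeometry.Hironaka2017.SpecOrders.shf (A 4 K) (Ideal.span {hyp p s.F})).support :
        Set (P 4 K)) at h
      rw [SetLike.mem_coe, Literature.AlgebraicGeometry.Hironaka2017.SpecOrders.mem_support_shf_iff,
        Ideal.span_singleton_le_iff_mem] at h
      exact h
    have hperm := (hW1 wt hwt).2.2.2.2.2.2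
    have hFmem := rename_mem_asIdeal_of_translate_mem_span
      (Ideal.pow_le_self hp0 (ChartDictionary.mem_pow_span_X_of_le_ordAlong p wt.2.2 _ hperm)) hx
    have hz0 : (X 0 : A 4 K) ^ p ∈ y.asIdeal := by
      have h := Ideal.sub_mem _ hhyp hFmem
      rwa [hyp, add_sub_cancel_right] at h
    exact Ideal.IsPrime.mem_of_pow_mem inferInstance p hz0

end RootHostDataH

end Equimultiple

end Summit.ResolutionOfSingularities.ResolutionOfSingularities.Theorems.PIDim4

end
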